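import Literature.AlgebraicGeometry.AbelianSchemes.HomEqualityLocusClosed
import Literature.AlgebraicGeometry.AbelianSchemes.AbelianSchemeQuotientMulNDescent
import Literature.AlgebraicGeometry.AbelianSchemes.AbelianSchemeFixedPowBaseChange
import HarnessLib

/-!
# The ENDOMORPHISM-STRUCTURE LOCUS of a family of endomorphisms of an abelian scheme is open and closed, and represents
# «the base change carries the ring action» ([Kottwitz1992] §5 pp. 389–391; [MumfordFogartyKirwan1994] Ch. 6 §1 Cor. 6.2 ∕ 6.4)

Layer `Literature/AlgebraicGeometry/AbelianSchemes`, namespace `Literature.AlgebraicGeometry.AbelianSchemes.AbelianSchemeOver`.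
THEOREMS ONLY (no definition, no named fact, no instance, no notation, no `sorry`).  Sequel of ★ (U1-a) `HomEqualityLocusClosed` (the
equality locus `E(f, g) ⊆ S` of two homomorphisms of abelian schemes over a locally Noetherian `S` is OPEN AND CLOSED and represents
«`f ×_S T = g ×_S T`» on locally Noetherian `S`-schemes).  Cell `hodgecm-mathlib` (D-0151), FLOOR 0, P6 «MOD programme» (crux hLiu418 =
stmt-HodgeConjecture-24832), SPREAD door of `stub_RGD`, GEN census `CENSUS-RGD-ASSEMBLY.v1` 09be7b9d (vi) (U1) ∕ R-CUT (R2): organ **(U1-b)**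
(LEAD F0P6-plan (g2) 2026-09-01 21:08:06Z (2); B-p18 (g37)).  HC_CM is proved only modulo the printed citations until rung 0 closes; this file is
generic and changes no count.

THE MATHEMATICS.  A PEL moduli problem parametrises, on a polarized abelian scheme `(A, λ)` over `S`, an action `ι : 𝒪 → End_S(A)` of an
order `𝒪` subject to the identities «`ι` is a ring homomorphism» and the Rosati condition «`ι(a^*) = λ⁻¹ ι(a)^∨ λ`» ([Kottwitz1992] §5).  With
`𝒪` FREE OF FINITE RANK over `ℤ` (basis `b₁, …, bₙ`, structure constants `b_k b_l = Σ_j c_{klj} b_j`, `1 = Σ_j u_j b_j`, involution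
`b_k^* = Σ_j s_{kj} b_j`) the DATA is `n` homomorphisms `y_j : A → A` (and the duals `y_j^∨ : Â → Â`), and the identities are FINITELY MANY
EQUALITIES OF HOMOMORPHISMS of abelian schemes — in the commutative group `Hom_S(A, A)` (pointwise product, Mathlib `Hom.commGroup`):
(E-M) `y_l ≫ y_k = ∏_j y_j^{c_{klj}}`, (E-U) `𝟙 = ∏_j y_j^{u_j}`, (E-R) `(∏_j y_j^{s_{kj}}) ≫ λ = λ ≫ y_k^∨`.  Hence ([MumfordFogartyKirwan1994]
Ch. 6 §1 rigidity, ★ (U1-a)) the locus of `s ∈ S` over which they hold is a FINITE INTERSECTION OF OPEN-AND-CLOSED equality loci: open and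
closed, representing «the identities hold after base change `T → S`» on locally Noetherian `T`; and over it the `y_j ×_S T` extend
(uniquely) to a ring action `ι_T(Σ a_j b_j) := ∏ (y_j ×_S T)^{a_j}` (★ `RingAction`).  [Kottwitz1992] §5 p. 390 calls the representability
of these closed conditions «standard»; this file is that standard argument.
* §1 **`exists_opens_isClosed_forall_iff_of_finite`** — a FINITE family of pairs of homomorphisms `f_j, g_j : A_j → B_j` of abelian schemes over
  `S`: one open `U ⊆ S` with closed underlying set such that `∀ j, f_j ×_S T = g_j ×_S T` iff `u(T) ⊆ U`.
* §2 the pointwise-product calculus of homomorphisms into a COMMUTATIVE abelian scheme (`isMonHom_finsetProd`, `isMonHom_zpow`,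
  `isMonHom_finsetProd_zpow`), and the ENDOMORPHISM-STRUCTURE LOCUS
  **`exists_opens_isClosed_structureTable_iff`** ((E-M)+(E-U), for ANY integer table `c`, `uc`) and **`exists_opens_isClosed_rosati_iff`** ((E-R),
  for any homomorphism `lam : A → A′` and given `yd_k : A′ → A′`, e.g. `lam = pol.lam`, `yd_k = dualIsogenyOver (y k) D D`), and the joint locus
  **`exists_opens_isClosed_structureTable_rosati_iff`**.
* §3 **`exists_ringAction_of_structureTable`** — where (E-M)+(E-U) hold, `ι(Σ a_j b_j) := ∏ y_j^{a_j}` IS a ★ `RingAction O A` with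
  `ι(b_j) = y_j`; conversely **`structureTable_of_ringAction`**, **`i_eq_finsetProd_zpow`** (a ring action is determined by the `ι(b_j)` and
  satisfies the table) — so the locus of §2 is exactly «the base change carries a ring action of `𝒪` extending the `y_j`».

## References
* [Kottwitz1992] R. Kottwitz, *Points on some Shimura varieties over finite fields*, JAMS 5 (1992), §5 (pp. 389–391).
* [MumfordFogartyKirwan1994] D. Mumford, J. Fogarty, F. Kirwan, *GIT*, 3rd ed., Ch. 6 §1 Corollary 6.2 (p. 116), Corollary 6.4 ∕ 6.5 (p. 117).
* [MumfordAV1970] D. Mumford, *Abelian Varieties* (1970), §19 (first paragraph: `Hom(X, Y)` is a group under pointwise addition), §20 (Rosati).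
* [GortzWedhorn2020] U. Görtz, T. Wedhorn, *Algebraic Geometry I*, 2nd ed. (2020), Section (4.7) (pp. 107–108).
-/

set_option autoImplicit false

noncomputable section

universe u

open CategoryTheory CategoryTheory.Limits AlgebraicGeometry MonoidalCategory CartesianMonoidalCategory TopologicalSpace
open scoped MonObj

namespace Literature.AlgebraicGeometry.AbelianSchemes

namespace AbelianSchemeOver

/-! ## §1 A finite family of equalities of homomorphisms: one open-and-closed representing locus -/

section Finite

variable {S : Scheme.{u}} [IsLocallyNoetherian S] {J : Type*} [Finite J] (A B : J → AbelianSchemeOver S)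
  (f g : ∀ j, (A j).X ⟶ (B j).X) [∀ j, IsMonHom (f j)] [∀ j, IsMonHom (g j)]

/-- **A FINITE family of equalities of homomorphisms of abelian schemes is represented by ONE open-and-closed locus**: for
`f_j, g_j : A_j → B_j` (`j ∈ J` finite) over a locally Noetherian `S` there is an open `U ⊆ S` with closed underlying set such that for
every locally Noetherian `T` and `u : T → S`: `f_j ×_S T = g_j ×_S T` for all `j` iff `u(T) ⊆ U` (the finite intersection of the ★ (U1-a)
loci `exists_opens_isClosed_forall_pullback_map_eq_iff`). [cite: MumfordFogartyKirwan1994, Ch. 6 §1 Corollary 6.2 (p. 116) and Corollary 6.4 (p. 117)]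
[cite: Kottwitz1992, §5 (p. 390)] -/
theorem exists_opens_isClosed_forall_iff_of_finite :
    ∃ U : S.Opens, IsClosed (U : Set S) ∧ ∀ ⦃T : Scheme.{u}⦄ [IsLocallyNoetherian T] (u : T ⟶ S),
      (∀ j, (Over.pullback u).map (f j) = (Over.pullback u).map (g j)) ↔ Set.range u.base ⊆ (U : Set S) := by
  choose U hUc hU using fun j => exists_opens_isClosed_forall_pullback_map_eq_iff (f j) (g j)
  refine ⟨⟨⋂ j, (U j : Set S), isOpen_iInter_of_finite fun j => (U j).isOpen⟩, isClosed_iInter fun j => hUc j, fun T _ u => ?_⟩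
  change (∀ j, _) ↔ Set.range u.base ⊆ ⋂ j, (U j : Set S)
  rw [Set.subset_iInter_iff]
  exact forall_congr' fun j => hU j u

end Finite

/-! ## §2 Pointwise products of homomorphisms into a commutative abelian scheme; the endomorphism-structure locus -/

section Products

variable {S : Scheme.{u}} {A : AbelianSchemeOver S} [IsCommMonObj A.X] {T : Over S} [GrpObj T]

/-- A finite pointwise product of homomorphisms into a commutative group scheme is a homomorphism (★ `isMonHom_mul`, induction).
[cite: MumfordFogartyKirwan1994, Ch. 6 §1 Cor. 6.5 (p. 117)] [cite: MumfordAV1970, §19 (first paragraph)] -/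
theorem isMonHom_finsetProd {J : Type*} (s : Finset J) (f : J → (T ⟶ A.X)) (hf : ∀ j ∈ s, IsMonHom (f j)) :
    IsMonHom (∏ j ∈ s, f j) := by
  classical
  induction s using Finset.induction_on with
  | empty => rw [Finset.prod_empty, Hom.one_def]; infer_instance
  | insert a s ha ih =>
    rw [Finset.prod_insert ha]
    haveI := hf a (Finset.mem_insert_self a s)
    haveI := ih fun j hj => hf j (Finset.mem_insert_of_mem hj)
    exact A.isMonHom_mul _ _

/-- An integer power (pointwise) of a homomorphism into a commutative group scheme is a homomorphism.
[cite: MumfordFogartyKirwan1994, Ch. 6 §1 Cor. 6.5 (p. 117)] [cite: MumfordAV1970, §19 (first paragraph)] -/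
theorem isMonHom_zpow (f : T ⟶ A.X) [IsMonHom f] (m : ℤ) : IsMonHom (f ^ m) := by
  have hnat : ∀ k : ℕ, IsMonHom (f ^ k) := by
    intro k
    induction k with
    | zero => rw [_root_.pow_zero, Hom.one_def]; infer_instance
    | succ k ih =>
      rw [_root_.pow_succ]
      haveI := ih
      exact A.isMonHom_mul _ _
  cases m with
  | ofNat k => rw [Int.ofNat_eq_natCast, zpow_natCast]; exact hnat k
  | negSucc k =>
    rw [zpow_negSucc]
    haveI := hnat (k + 1)
    infer_instance

/-- A finite product of integer powers of homomorphisms is a homomorphism. [cite: MumfordAV1970, §19 (first paragraph)] -/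
theorem isMonHom_finsetProd_zpow {J : Type*} (s : Finset J) (f : J → (T ⟶ A.X)) [∀ j, IsMonHom (f j)] (c : J → ℤ) :
    IsMonHom (∏ j ∈ s, f j ^ c j) :=
  isMonHom_finsetProd s _ fun j _ => isMonHom_zpow (f j) (c j)

end Products

section Locus

variable {S : Scheme.{u}} [IsLocallyNoetherian S] (A : AbelianSchemeOver S) [IsCommMonObj A.X] {n : ℕ}
  (y : Fin n → (A.X ⟶ A.X)) [∀ j, IsMonHom (y j)]

/-- **THE ENDOMORPHISM-STRUCTURE LOCUS, (E-M)+(E-U).**  For homomorphisms `y₁, …, yₙ : A → A` of a commutative abelian scheme over a locally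
Noetherian `S`, an integer MULTIPLICATION TABLE `c : Fin n → Fin n → Fin n → ℤ` and UNIT COORDINATES `uc : Fin n → ℤ` (the structure
constants of an order `𝒪 = ⊕ ℤ b_j`: `b_k b_l = Σ_j c_{klj} b_j`, `1 = Σ_j uc_j b_j`), there is an open `U ⊆ S` with closed underlying set
such that for every locally Noetherian `T` and `u : T → S`, the identities of the table —
(E-M) `y_l ≫ y_k = ∏_j y_j^{c_{klj}}` for all `k, l` and (E-U) `𝟙 = ∏_j y_j^{uc_j}` — hold AFTER BASE CHANGE along `u` iff `u(T) ⊆ U`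
(§1 on the `n² + 1` pairs; [Kottwitz1992] §5 p. 390 «these conditions are closed»; the products live in the commutative group `Hom_S(A, A)`,
their base changes are finite products again by ★ `SerreTensorBaseChange.pullback_map_finset_prod` when the consumer holds the commutativity of `A ×_S T`). [cite: Kottwitz1992, §5 (p. 390)]
[cite: MumfordFogartyKirwan1994, Ch. 6 §1 Corollary 6.2 (p. 116) and Corollary 6.4 (p. 117)] -/
theorem exists_opens_isClosed_structureTable_iff (c : Fin n → Fin n → Fin n → ℤ) (uc : Fin n → ℤ) :
    ∃ U : S.Opens, IsClosed (U : Set S) ∧ ∀ ⦃T : Scheme.{u}⦄ [IsLocallyNoetherian T] (u : T ⟶ S),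
      ((∀ k l, (Over.pullback u).map (y l ≫ y k) = (Over.pullback u).map (∏ j, y j ^ c k l j)) ∧
        (Over.pullback u).map (𝟙 A.X) = (Over.pullback u).map (∏ j, y j ^ uc j)) ↔ Set.range u.base ⊆ (U : Set S) := by
  -- index the `n² + 1` identities by `Option (Fin n × Fin n)`
  let f : Option (Fin n × Fin n) → (A.X ⟶ A.X) := fun o => o.elim (𝟙 A.X) fun kl => y kl.2 ≫ y kl.1
  let g : Option (Fin n × Fin n) → (A.X ⟶ A.X) := fun o =>
    o.elim (∏ j, y j ^ uc j) fun kl => ∏ j, y j ^ c kl.1 kl.2 j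
  haveI : ∀ o, IsMonHom (f o) := fun o => by
    cases o with
    | none => change IsMonHom (𝟙 A.X); infer_instance
    | some kl => change IsMonHom (y kl.2 ≫ y kl.1); infer_instance
  haveI : ∀ o, IsMonHom (g o) := fun o => by
    cases o with
    | none => exact isMonHom_finsetProd_zpow Finset.univ y uc
    | some kl => exact isMonHom_finsetProd_zpow Finset.univ y (c kl.1 kl.2)
  obtain ⟨U, hUc, hU⟩ := exists_opens_isClosed_forall_iff_of_finite (fun _ => A) (fun _ => A) f g
  refine ⟨U, hUc, fun T _ u => Iff.trans ?_ (hU u)⟩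
  constructor
  · rintro ⟨hM, hU1⟩ o
    cases o with
    | none => exact hU1
    | some kl => exact hM kl.1 kl.2
  · intro h
    exact ⟨fun k l => h (some (k, l)), h none⟩

/-- **THE ROSATI LOCUS, (E-R).**  For `y₁, …, yₙ : A → A` as above, a homomorphism `lam : A → A′` (the polarization `λ : A → Â`),
homomorphisms `yd_k : A′ → A′` (the duals `y_k^∨`, e.g. ★ `dualIsogenyOver (y k) D D`) and an integer matrix `sm : Fin n → Fin n → ℤ` (the
involution `b_k^* = Σ_j sm_{kj} b_j`), the locus where the Rosati identities (E-R) `(∏_j y_j^{sm_{kj}}) ≫ lam = lam ≫ yd_k` (`λ⁻¹`-free form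
of «`ι(a^*) = λ⁻¹ ι(a)^∨ λ`») hold after base change is represented by an open `U ⊆ S` with closed underlying set.
[cite: Kottwitz1992, §5 (p. 390)] [cite: MumfordAV1970, §20 (pp. 189–190)] -/
theorem exists_opens_isClosed_rosati_iff {A' : AbelianSchemeOver S} (lam : A.X ⟶ A'.X) [IsMonHom lam]
    (yd : Fin n → (A'.X ⟶ A'.X)) [∀ k, IsMonHom (yd k)] (sm : Fin n → Fin n → ℤ) :
    ∃ U : S.Opens, IsClosed (U : Set S) ∧ ∀ ⦃T : Scheme.{u}⦄ [IsLocallyNoetherian T] (u : T ⟶ S),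
      (∀ k, (Over.pullback u).map ((∏ j, y j ^ sm k j) ≫ lam) = (Over.pullback u).map (lam ≫ yd k)) ↔
        Set.range u.base ⊆ (U : Set S) := by
  haveI : ∀ k, IsMonHom ((∏ j, y j ^ sm k j) ≫ lam) := fun k => by
    haveI := isMonHom_finsetProd_zpow Finset.univ y (sm k)
    infer_instance
  exact exists_opens_isClosed_forall_iff_of_finite (fun _ : Fin n => A) (fun _ => A')
    (fun k => (∏ j, y j ^ sm k j) ≫ lam) (fun k => lam ≫ yd k)

/-- **THE PEL ENDOMORPHISM-STRUCTURE LOCUS (table + unit + Rosati together)**: one open `U ⊆ S` with closed underlying set representing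
«(E-M) ∧ (E-U) ∧ (E-R) hold after base change» (the intersection of the two loci above). [cite: Kottwitz1992, §5 (pp. 389–391)] -/
theorem exists_opens_isClosed_structureTable_rosati_iff (c : Fin n → Fin n → Fin n → ℤ) (uc : Fin n → ℤ)
    {A' : AbelianSchemeOver S} (lam : A.X ⟶ A'.X) [IsMonHom lam] (yd : Fin n → (A'.X ⟶ A'.X)) [∀ k, IsMonHom (yd k)]
    (sm : Fin n → Fin n → ℤ) :
    ∃ U : S.Opens, IsClosed (U : Set S) ∧ ∀ ⦃T : Scheme.{u}⦄ [IsLocallyNoetherian T] (u : T ⟶ S),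
      (((∀ k l, (Over.pullback u).map (y l ≫ y k) = (Over.pullback u).map (∏ j, y j ^ c k l j)) ∧
        (Over.pullback u).map (𝟙 A.X) = (Over.pullback u).map (∏ j, y j ^ uc j)) ∧
        ∀ k, (Over.pullback u).map ((∏ j, y j ^ sm k j) ≫ lam) = (Over.pullback u).map (lam ≫ yd k)) ↔
        Set.range u.base ⊆ (U : Set S) := by
  obtain ⟨U₁, h₁c, h₁⟩ := A.exists_opens_isClosed_structureTable_iff y c uc
  obtain ⟨U₂, h₂c, h₂⟩ := A.exists_opens_isClosed_rosati_iff y lam yd sm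
  refine ⟨U₁ ⊓ U₂, ?_, fun T _ u => ?_⟩
  · exact IsClosed.inter h₁c h₂c
  · rw [h₁ u, h₂ u]
    exact Set.subset_inter_iff.symm

end Locus

/-! ## §3 Over the locus the endomorphisms ARE a ring action: `ι(Σ a_j b_j) := ∏ y_j^{a_j}` -/

section Extension

variable {S : Scheme.{u}} {A : AbelianSchemeOver S} [IsCommMonObj A.X] {T : Over S}

/-- Precomposition distributes over finite products of integer powers: `f ≫ ∏ g_j^{c_j} = ∏ (f ≫ g_j)^{c_j}` (Mathlib `MonObj.comp_mul`,
any `f`). [cite: MumfordAV1970, §19 (first paragraph)] -/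
theorem comp_finsetProd_zpow {T' : Over S} (f : T' ⟶ T) {J : Type*} (s : Finset J) (g : J → (T ⟶ A.X)) (c : J → ℤ) :
    f ≫ (∏ j ∈ s, g j ^ c j) = ∏ j ∈ s, (f ≫ g j) ^ c j := by
  let φ : (T ⟶ A.X) →* (T' ⟶ A.X) :=
    { toFun := fun g => f ≫ g, map_one' := MonObj.comp_one f, map_mul' := MonObj.comp_mul f }
  change φ (∏ j ∈ s, g j ^ c j) = ∏ j ∈ s, φ (g j) ^ c j
  rw [map_prod]
  exact Finset.prod_congr rfl fun j _ => map_zpow φ (g j) (c j)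

/-- Postcomposition with a HOMOMORPHISM distributes over finite products of integer powers: `(∏ g_j^{c_j}) ≫ h = ∏ (g_j ≫ h)^{c_j}`
(Mathlib `IsMonHom.monoidHom`). [cite: MumfordAV1970, §19 (first paragraph)] -/
theorem finsetProd_zpow_comp {B : AbelianSchemeOver S} [IsCommMonObj B.X] (h : A.X ⟶ B.X) [IsMonHom h] {J : Type*} (s : Finset J)
    (g : J → (T ⟶ A.X)) (c : J → ℤ) :
    (∏ j ∈ s, g j ^ c j) ≫ h = ∏ j ∈ s, (g j ≫ h) ^ c j := by
  change IsMonHom.monoidHom h T (∏ j ∈ s, g j ^ c j) = ∏ j ∈ s, IsMonHom.monoidHom h T (g j) ^ c j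
  rw [map_prod]
  exact Finset.prod_congr rfl fun j _ => map_zpow (IsMonHom.monoidHom h T) (g j) (c j)

variable {O : Type*} [CommRing O] {n : ℕ} (bs : Module.Basis (Fin n) ℤ O) (y : Fin n → (A.X ⟶ A.X))

/-- The candidate action `a ↦ ∏_j y_j^{a_j}` (`a = Σ a_j b_j`) is ADDITIVE: sums to pointwise products. [cite: Kottwitz1992, §5 (p. 390)] -/
theorem finsetProd_zpow_repr_add (a b : O) :
    ∏ j, y j ^ (bs.repr (a + b) j) = (∏ j, y j ^ (bs.repr a j)) * ∏ j, y j ^ (bs.repr b j) := by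
  rw [← Finset.prod_mul_distrib]
  exact Finset.prod_congr rfl fun j _ => by rw [map_add, Finsupp.add_apply, zpow_add]

/-- … sends `0` to the unit. [cite: Kottwitz1992, §5 (p. 390)] -/
theorem finsetProd_zpow_repr_zero : ∏ j, y j ^ (bs.repr (0 : O) j) = 1 := by
  simp only [map_zero, Finsupp.coe_zero, Pi.zero_apply, zpow_zero, Finset.prod_const_one]

/-- … sends finite sums to products. [cite: Kottwitz1992, §5 (p. 390)] -/
theorem finsetProd_zpow_repr_sum {J : Type*} (s : Finset J) (a : J → O) :
    ∏ j, y j ^ (bs.repr (∑ i ∈ s, a i) j) = ∏ i ∈ s, ∏ j, y j ^ (bs.repr (a i) j) := by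
  classical
  induction s using Finset.induction_on with
  | empty => rw [Finset.sum_empty, Finset.prod_empty, finsetProd_zpow_repr_zero]
  | insert i s hi ih => rw [Finset.sum_insert hi, Finset.prod_insert hi, finsetProd_zpow_repr_add, ih]

/-- … sends `m • a` to the `m`-th power. [cite: Kottwitz1992, §5 (p. 390)] -/
theorem finsetProd_zpow_repr_zsmul (m : ℤ) (a : O) :
    ∏ j, y j ^ (bs.repr (m • a) j) = (∏ j, y j ^ (bs.repr a j)) ^ m := by
  rw [← Finset.prod_zpow]
  exact Finset.prod_congr rfl fun j _ => by rw [map_zsmul, Finsupp.smul_apply, smul_eq_mul, mul_comm, zpow_mul]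

/-- … and sends the basis vector `b_k` to `y_k`. [cite: Kottwitz1992, §5 (p. 390)] -/
theorem finsetProd_zpow_repr_basis (k : Fin n) : ∏ j, y j ^ (bs.repr (bs k) j) = y k := by
  rw [bs.repr_self, Finset.prod_eq_single k]
  · rw [Finsupp.single_eq_same, zpow_one]
  · intro j _ hjk
    rw [Finsupp.single_apply, if_neg (Ne.symm hjk), zpow_zero]
  · intro hk
    exact absurd (Finset.mem_univ k) hk

variable [∀ j, IsMonHom (y j)]

/-- **OVER THE ENDOMORPHISM-STRUCTURE LOCUS THE `y_j` ARE A RING ACTION.**  If the homomorphisms `y₁, …, yₙ : A → A` of a commutative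
abelian scheme satisfy the multiplication table (E-M) `y_l ≫ y_k = ∏_j y_j^{c_{klj}}`, `c_{klj} = (b_k b_l)_j`, and the unit identity (E-U)
`𝟙 = ∏_j y_j^{(1)_j}` of an order `𝒪` with ℤ-basis `b`, then `ι(a) := ∏_j y_j^{a_j}` IS a ring action of `𝒪` on `A` (★ `RingAction`) with
`ι(b_j) = y_j`: additivity is free, `ι(1) = 𝟙` is (E-U), and `ι(ab) = ι(b) ≫ ι(a)` follows from (E-M) by bilinear expansion in the basis
(composition distributes over pointwise products on both sides, the `y_k` being homomorphisms).  Apply over any `T → S` mapping into the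
locus of §2. [cite: Kottwitz1992, §5 (pp. 389–390)] [cite: MumfordAV1970, §19 (first paragraph)] -/
theorem exists_ringAction_of_structureTable
    (hM : ∀ k l, y l ≫ y k = ∏ j, y j ^ (bs.repr (bs k * bs l) j)) (hU : 𝟙 A.X = ∏ j, y j ^ (bs.repr 1 j)) :
    ∃ act : RingAction O A, ∀ j, act.i (bs j) = y j := by
  refine ⟨{ i := fun a => ∏ j, y j ^ (bs.repr a j)
            isMonHom := fun a => isMonHom_finsetProd_zpow Finset.univ y _
            i_one := hU.symm
            i_mul := fun a b => ?_
            i_zero := finsetProd_zpow_repr_zero bs y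
            i_add := finsetProd_zpow_repr_add bs y }, finsetProd_zpow_repr_basis bs y⟩
  -- expand `a`, `b` in the basis: both sides equal `∏_k ∏_l (y_l ≫ y_k)^{a_k b_l}`
  have hab : a * b = ∑ k, ∑ l, (bs.repr a k * bs.repr b l) • (bs k * bs l) := by
    conv_lhs => rw [← bs.sum_repr a, ← bs.sum_repr b]
    rw [Finset.sum_mul_sum]
    refine Finset.sum_congr rfl fun k _ => Finset.sum_congr rfl fun l _ => ?_
    rw [zsmul_eq_mul, zsmul_eq_mul, zsmul_eq_mul, Int.cast_mul]
    ring
  change ∏ j, y j ^ (bs.repr (a * b) j) = (∏ j, y j ^ (bs.repr b j)) ≫ ∏ j, y j ^ (bs.repr a j)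
  rw [hab, finsetProd_zpow_repr_sum bs y]
  simp_rw [finsetProd_zpow_repr_sum bs y, finsetProd_zpow_repr_zsmul bs y, ← hM]
  -- right-hand side: distribute the composition
  rw [comp_finsetProd_zpow]
  refine Finset.prod_congr rfl fun k _ => ?_
  rw [finsetProd_zpow_comp (y k), ← Finset.prod_zpow]
  exact Finset.prod_congr rfl fun l _ => by rw [← zpow_mul, mul_comm]

/-- **Conversely, a ring action satisfies the table**: for `act : RingAction O A` and `y_j := ι(b_j)`, every `ι(a)` is `∏_j y_j^{a_j}`, and
(E-M), (E-U) hold. [cite: Kottwitz1992, §5 (p. 390)] -/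
theorem i_eq_finsetProd_zpow (act : RingAction O A) (a : O) : act.i a = ∏ j, act.i (bs j) ^ (bs.repr a j) := by
  have hsum : ∀ (s : Finset (Fin n)) (g : Fin n → O), act.i (∑ i ∈ s, g i) = ∏ i ∈ s, act.i (g i) := by
    intro s g
    induction s using Finset.induction_on with
    | empty => rw [Finset.sum_empty, Finset.prod_empty, act.i_zero]
    | insert i s hi ih => rw [Finset.sum_insert hi, Finset.prod_insert hi, act.i_add, ih]
  have hzsmul : ∀ (m : ℤ) (x : O), act.i (m • x) = act.i x ^ m := by
    intro m x
    induction m using Int.induction_on with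
    | zero => rw [zero_smul, act.i_zero, zpow_zero]
    | succ m ih => rw [add_smul, one_smul, act.i_add, ih, zpow_add, zpow_one]
    | pred m ih => rw [sub_smul, one_smul, act.i_sub, ih, zpow_sub, zpow_one]
  conv_lhs => rw [← bs.sum_repr a]
  rw [hsum Finset.univ]
  exact Finset.prod_congr rfl fun j _ => hzsmul _ _

/-- (E-M) and (E-U) for the endomorphisms `ι(b_j)` of a ring action. [cite: Kottwitz1992, §5 (p. 390)] -/
theorem structureTable_of_ringAction (act : RingAction O A) :
    (∀ k l, act.i (bs l) ≫ act.i (bs k) = ∏ j, act.i (bs j) ^ (bs.repr (bs k * bs l) j)) ∧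
      𝟙 A.X = ∏ j, act.i (bs j) ^ (bs.repr 1 j) := by
  refine ⟨fun k l => ?_, ?_⟩
  · rw [← act.i_mul, i_eq_finsetProd_zpow bs act]
  · rw [← act.i_one, i_eq_finsetProd_zpow bs act (1 : O)]

end Extension

end AbelianSchemeOver

end Literature.AlgebraicGeometry.AbelianSchemes

end
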